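import Mathlib.Topology.Algebra.ContinuousMonoidHom
import Mathlib.Topology.Algebra.Group.Quotient
import Mathlib.Topology.Instances.ZMod
import Mathlib.GroupTheory.QuotientGroup.Basic
import Mathlib.Algebra.Group.End
import Mathlib.Algebra.Group.Subgroup.Map
import Mathlib.RingTheory.RootsOfUnity.PrimitiveRoots
import Mathlib.Data.ZMod.Basic
import Mathlib.Data.PNat.Basic
import Literature.IUT.HodgeTheaters.DiscreteProfiniteConjugates
import Literature.IUT.HodgeArakelov.ThetaEvaluationSubgraphs
import HarnessLib

/-!
# [IUTchII] §1, Definition 1.1: the cyclotomes of a mono-theta environment (statements-first)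

Mochizuki, *Inter-universal Teichmüller theory II: Hodge–Arakelov-theoretic evaluation*, §1
"Multiradial Mono-theta Environments", kurims manuscript (Dec. 2020) pp. 20–21: the fixed data of
§1 (p. 20), and Definition 1.1 (i), (ii) [claim: Mochizuki2012, status: disputed] (IUTchII §1 Def 1.1, kurims pp.20-21).
Record-only typing under the claim key `Mochizuki2012` (D-0012, status disputed): this file contains
DEFINITIONS and `Prop`-valued statements only; nothing is asserted.

## What is typed, and how ("functorial group-theoretic algorithms")

Definition 1.1 has the genre "there exist functorial algorithms `M ↦ Π_Y(M)`, … for constructing from a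
mono-theta environment `M` a quotient / a topological group / a subquotient … [cf. [EtTh], Cor. 2.18,
2.19]". Following the PRINTED form of [EtTh] Corollary 2.18 (i) ("… which have the property that any
isomorphism `Π• ≅ Π^tp` maps the above subquotients, respectively, to the subquotients … of `Π^tp`"),
we type such an algorithm by its OUTPUT: a structure of data over the input (`TopGroup`s, homomorphisms,
subquotients) whose `Prop`-fields quote the printed properties, the clause "corresponding to `G_k`" /
"isomorphic to `Π^tp`" being rendered as the existence of an isomorphism with the REFERENCE object of the
setting that matches the reference datum. The printed existence claim is then the named fact
`∀ input, Nonempty (Output input)` (`def … : Prop`, D-0014). Functoriality in isomorphisms of the input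
is recorded in the docstrings; where the text states a specific functorial isomorphism or equivariance
it is a field. (Cell policy FOUNDATIONS row 41: the mono-anabelian nature of an algorithm lives in its
DOMAIN — here the bare mono-theta environment, never the curve.)

## Interfaces (absent deep inputs; each flagged `TODO-merge:<owner seat>`)

* `TopGroup`, `Subquotient`, `ModPow`: generic — TODO-merge:abc-iut-L4-t1 / abc-iut-found (campaign
  conventions file); `Ẑ` is `Literature.IUT.HodgeTheaters.ZHat` (profinite completion of `ℤ`, L5-t1), and
  `Ẑ^×` is realised as `ZHatUnits := MulAut Ẑ`.
* `ThetaSetting`: the data fixed at the start of §1 (p. 20): `N ≥ 1`, `l` an odd prime, `k` an MLF of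
  odd residue characteristic `p ≠ l` containing a primitive `4l`-th root of unity, `X̲̲_k` a hyperbolic
  curve of type `(1,(ℤ/lℤ)^Θ)` ([EtTh] Def. 2.5 (i)) with stable model, its tempered fundamental group
  `Π^tp_{X̲̲_k} ↠ G_k` with kernel `Δ^tp_{X̲̲_k}` — the tempered group enters as an INTERFACE
  (TODO-merge:abc-iut-L3-t2, [SemiAnbd] §3); the MLF `k` is carried as a bare field with the printed
  root-of-unity hypothesis (TODO-merge:abc-iut-S1 for the MLF structure).
* `MonoThetaEnv S`: a mod `N` mono-theta environment = "a topological group `Π`, a subgroup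
  `D_Π ⊆ Out(Π)`, and a collection of subgroups `s^Θ_Π` of `Π`" admitting an isomorphism to the model
  ([EtTh] Def. 2.13 (ii), p. 44) — TODO-merge:abc-iut-L2-t2. `D_Π ⊆ Out(Π)` is carried as a subgroup of
  `Aut(Π)` containing the inner automorphisms and consisting of homeomorphisms (the two notions are in
  canonical bijection); the model
  mono-theta environment of `S` is a field of the setting (its [EtTh] construction is L2-t2's).

## Text-extraction caveat (for the referee)

The kurims PDF text layer drops under/over-lining of symbols. Decorations are restored from [EtTh]
Remark 2.3.1 ("single underline" `X̲, C̲` = type `(1,l-tors)`, `(1,l-tors)_±`; "double underline"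
`X̲̲, C̲̲` = type `(1,l-tors^Θ)`, `(1,l-tors^Θ)_±`) and Def. 2.5; Lean names use the bare letters of the
printed symbols (`PiX`, `PiY`, …), the docstrings give the decorated symbol.

GENUINENESS (reviews of the first two submissions): the interface fields of `ThetaSetting` carry no axioms, so an
existence claim quantified over ALL settings would be false for junk settings, while the transport form "exists
for one isomorph → exists for all" is trivially provable; hence NO existence clause of this section is typed as
a named fact. What is typed is the OUTPUT of each "functorial algorithm" (structures whose `Prop` fields quote
print) and the properties print asserts of it as predicates on that output; the existence content is the
owners' construction for the genuine model ([EtTh], abc-iut-L2-t2). The cyclotomic rigidity datum is bundled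
with the Def. 1.1 (i) output (`Def11Output`) so that its equivariance refers to the actions produced by the
SAME algorithm.

Deliberately NOT here: Remark 1.1.1 (separate file), the [EtTh] constructions behind the interfaces,
any scheme-theoretic object.
-/

namespace Literature.IUT.HodgeArakelov

universe u

/-! ## Generic vocabulary (TODO-merge:abc-iut-L4-t1 / abc-iut-found) -/

/-- A bundled topological group (no separation or compactness assumed: tempered fundamental groups
are not profinite). Generic campaign vocabulary. [claim: Mochizuki2012, status: disputed] (IUTchII §1, kurims p.20) -/
structure TopGroup : Type (u + 1) where
  /-- the underlying type -/
  carrier : Type u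
  [group : Group carrier]
  [topology : TopologicalSpace carrier]
  [topGroup : IsTopologicalGroup carrier]

namespace TopGroup

attribute [instance] TopGroup.group TopGroup.topology TopGroup.topGroup

/-- A bundled topological group coerces to its underlying type. [claim: Mochizuki2012, status: disputed] (IUTchII §1, kurims p.20) -/
instance : CoeSort TopGroup.{u} (Type u) := ⟨TopGroup.carrier⟩

/-- Bundle an unbundled topological group. [claim: Mochizuki2012, status: disputed] (IUTchII §1, kurims p.20) -/
abbrev of (G : Type u) [Group G] [TopologicalSpace G] [IsTopologicalGroup G] : TopGroup.{u} := ⟨G⟩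

/-- A (closed, open, …) subgroup of a topological group, bundled again as a topological group with the
subspace topology. [claim: Mochizuki2012, status: disputed] (IUTchII §1, kurims p.20) -/
abbrev ofSubgroup (G : TopGroup.{u}) (H : Subgroup G) : TopGroup.{u} := ⟨H⟩

/-- The quotient of a topological group by a normal subgroup, as a topological group.
[claim: Mochizuki2012, status: disputed] (IUTchII §1, kurims p.20) -/
abbrev quot (G : TopGroup.{u}) (N : Subgroup G) [N.Normal] : TopGroup.{u} := ⟨G ⧸ N⟩

end TopGroup

/-! A *subquotient* `top / bot` of a group (Mochizuki's "subquotient of `Π`", e.g. `(l·Δ_Θ)`) is the tree's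
`Literature.IUT.HodgeArakelov.Subquotient` (fields `top bot le normal`; landed in `ThetaEvaluationSubgraphs.lean`,
abc-iut-L6-t2, p404618) — imported, not re-declared (C9); we only add the carrier type and transport. -/

namespace Subquotient

variable {G : Type u} [Group G]

attribute [instance] Subquotient.normal

/-- The subquotient as a type `top ⧸ (bot ⊓ top)`. [claim: Mochizuki2012, status: disputed] (IUTchII §1 Def 1.1 (i), kurims p.21) -/
abbrev carrier (Q : Subquotient G) : Type u := Q.top ⧸ Q.bot.subgroupOf Q.top

/-- Transport of a subquotient along a group isomorphism. [claim: Mochizuki2012, status: disputed] (IUTchII §1, kurims p.20) -/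
def map {H : Type u} [Group H] (Q : Subquotient G) (e : G ≃* H) : Subquotient H where
  top := Q.top.map e.toMonoidHom
  bot := Q.bot.map e.toMonoidHom
  le := Subgroup.map_mono Q.le
  normal := by
    have hn : (Q.bot.subgroupOf Q.top).Normal := Q.normal
    rw [Subgroup.normal_subgroupOf_iff Q.le] at hn
    rw [Subgroup.normal_subgroupOf_iff (Subgroup.map_mono Q.le)]
    rintro _ _ ⟨h, hh, rfl⟩ ⟨k, hk, rfl⟩
    refine ⟨k * h * k⁻¹, hn h k hh hk, ?_⟩
    simp

end Subquotient

/-- The **reduction modulo `n`** `A ⊗ ℤ/nℤ` of a (multiplicatively written, in practice abelian) group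
`A`: the quotient by the normal closure of the `n`-th powers (for abelian `A` this is `A/A^n`).
[claim: Mochizuki2012, status: disputed] (IUTchII §1 Def 1.1 (ii), kurims p.21) -/
abbrev ModPow (A : Type u) [Group A] (n : ℕ) : Type u :=
  A ⧸ Subgroup.normalClosure (Set.range fun a : A => a ^ n)

/-- `Ẑ^×`, realised as the automorphism group of the profinite group `Ẑ = Literature.IUT.HodgeTheaters.ZHat`
(`Aut(Ẑ) = Ẑ^×`; every abstract automorphism of the topologically cyclic group `Ẑ` is continuous).
[claim: Mochizuki2012, status: disputed] (IUTchII §1 Ex 1.8 (iii), kurims p.37) -/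
abbrev ZHatUnits : Type := MulAut Literature.IUT.HodgeTheaters.ZHat

/-! ## The fixed data of §1 (p. 20) -/

/-- **The data fixed at the beginning of [IUTchII] §1** (p. 20): "Let `N ∈ ℕ_{≥1}` be a positive integer;
`l` an odd prime number; `k` an MLF of odd residue characteristic `p ≠ l` that contains a primitive
`4l`-th root of unity; `k̄` an algebraic closure of `k`; `X̲̲_k` a hyperbolic curve of type `(1,(ℤ/lℤ)^Θ)`
[cf. [EtTh], Definition 2.5, (i)] over `k` that admits a stable model over the ring of integers `O_k` of
`k`; `X̲̲_k → C_k` the `k`-core determined by `X̲̲_k`. Write `Π^tp_{X̲̲_k}` for the tempered fundamental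
group of `X̲̲_k`; `G_k := Gal(k̄/k)`; `Δ^tp_{X̲̲_k} := Ker(Π^tp_{X̲̲_k} ↠ G_k)`."

INTERFACE: the curve and its tempered fundamental group enter only through the augmented topological
group `PiX ↠ Gk` (TODO-merge:abc-iut-L3-t2); the MLF structure of `k` is not modelled
(TODO-merge:abc-iut-S1) — only the printed hypotheses on `N, l, p` and the `4l`-th root of unity are.
The mod `N` MODEL mono-theta environment "determined by `X̲̲_k`" ([EtTh] Def. 2.13 (ii)) is carried as
reference data `modelPi, modelD, modelTheta` (TODO-merge:abc-iut-L2-t2).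
[claim: Mochizuki2012, status: disputed] (IUTchII §1, kurims p.20) -/
structure ThetaSetting : Type (u + 1) where
  /-- `N ∈ ℕ_{≥1}` -/
  N : ℕ+
  /-- the odd prime `l` -/
  l : ℕ
  l_prime : l.Prime
  l_odd : l ≠ 2
  /-- the residue characteristic `p` of `k` -/
  p : ℕ
  p_prime : p.Prime
  p_odd : p ≠ 2
  p_ne_l : p ≠ l
  /-- the MLF `k` (bare field; MLF structure not modelled here) -/
  k : Type u
  [field : Field k]
  [charZero : CharZero k]
  /-- "`k` contains a primitive `4l`-th root of unity" -/
  hasPrimitiveRoot : ∃ ζ : k, IsPrimitiveRoot ζ (4 * l)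
  /-- `Π^tp_{X̲̲_k}`, the tempered fundamental group of `X̲̲_k` (interface) -/
  PiX : TopGroup.{u}
  /-- `G_k = Gal(k̄/k)` (interface) -/
  Gk : TopGroup.{u}
  /-- the augmentation `Π^tp_{X̲̲_k} ↠ G_k` -/
  aug : PiX →* Gk
  aug_continuous : Continuous aug
  aug_surjective : Function.Surjective aug
  /-- underlying topological group `Π^tp_{Y̲}[μ_N]` of the mod `N` model mono-theta environment
  ([EtTh] Def. 2.13 (ii)(a)) -/
  modelPi : TopGroup.{u}
  /-- the subgroup `D_Y ⊆ Out(·)` of the model, as a subgroup of `Aut` containing `Inn`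
  ([EtTh] Def. 2.13 (ii)(b)) -/
  modelD : Subgroup (MulAut modelPi)
  modelD_inn : (MulAut.conj : modelPi →* MulAut modelPi).range ≤ modelD
  /-- `Out(·)` of a TOPOLOGICAL group: the automorphisms in `D` are homeomorphisms -/
  modelD_continuous : ∀ φ ∈ modelD, Continuous φ ∧ Continuous φ.symm
  /-- the `μ_N`-conjugacy class of subgroups determined by the theta section ([EtTh] Def. 2.13 (ii)(c)) -/
  modelTheta : Set (Subgroup modelPi)

namespace ThetaSetting

attribute [instance] ThetaSetting.field ThetaSetting.charZero

/-- `Δ^tp_{X̲̲_k} := Ker(Π^tp_{X̲̲_k} ↠ G_k)`, the geometric tempered fundamental group (p. 20).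
[claim: Mochizuki2012, status: disputed] (IUTchII §1, kurims p.20) -/
abbrev DeltaX (S : ThetaSetting.{u}) : Subgroup S.PiX := S.aug.ker

end ThetaSetting

/-! ## Mono-theta environments ([EtTh] Def. 2.13 (ii)) — interface, TODO-merge:abc-iut-L2-t2 -/

/-- A **mod `N` mono-theta environment** in the setting `S`, [EtTh] Definition 2.13 (ii) (kurims p. 44)
as used in [IUTchII] Definition 1.1: "any [ordered] collection of data consisting of a topological group
`Π`, a subgroup `D_Π ⊆ Out(Π)`, and a collection of subgroups `s^Θ_Π` of `Π` such that there exists an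
isomorphism of topological groups `Π ≅ Π^tp_{Y̲}[μ_N]` mapping `D_Π ⊆ Out(Π)` to `D_Y` and `s^Θ_Π` to the
`μ_N`-conjugacy class of (c)" — i.e. "isomorphic to the mod `N` model mono-theta environment determined
by `X̲̲_k`" (IUTchII p. 20). `D_Π` is carried as a subgroup of `Aut(Π)` containing `Inn(Π)`.
[claim: Mochizuki2012, status: disputed] (IUTchII §1 Def 1.1, kurims p.20) -/
structure MonoThetaEnv (S : ThetaSetting.{u}) : Type (u + 1) where
  /-- the underlying topological group `Π_{M^Θ}` ([EtTh] Def. 2.13 (ii)(a); IUTchII p. 20) -/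
  Pi : TopGroup.{u}
  /-- `D_Π ⊆ Out(Π)`, as a subgroup of `Aut(Π)` containing the inner automorphisms -/
  D : Subgroup (MulAut Pi)
  D_inn : (MulAut.conj : Pi →* MulAut Pi).range ≤ D
  /-- `Out(Π)` of a TOPOLOGICAL group: the automorphisms in `D` are homeomorphisms (carried as abstract
  automorphisms plus this continuity condition) -/
  D_continuous : ∀ φ ∈ D, Continuous φ ∧ Continuous φ.symm
  /-- the collection of subgroups `s^Θ_Π` ("theta section portion") -/
  theta : Set (Subgroup Pi)
  /-- "isomorphic to the mod `N` model mono-theta environment determined by `X̲̲_k`" -/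
  isModel : ∃ e : Pi ≃ₜ* S.modelPi,
    D.map (MulAut.congr e.toMulEquiv).toMonoidHom = S.modelD ∧
    (fun H : Subgroup Pi => H.map e.toMulEquiv.toMonoidHom) '' theta = S.modelTheta

namespace MonoThetaEnv

variable {S : ThetaSetting.{u}}

/-- An **isomorphism of mono-theta environments** `M ≅ M'` ([EtTh] Def. 2.13 (ii), p. 44): "any
isomorphism of topological groups `Π ≅ Π'` that maps `D_Π ↦ D_{Π'}`, `s^Θ_Π ↦ s^Θ_{Π'}`".
[claim: Mochizuki2012, status: disputed] (IUTchII §1 Def 1.1, kurims p.20) -/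
structure Iso (M M' : MonoThetaEnv S) : Type u where
  /-- the underlying isomorphism of topological groups -/
  iso : M.Pi ≃ₜ* M'.Pi
  map_D : M.D.map (MulAut.congr iso.toMulEquiv).toMonoidHom = M'.D
  map_theta : (fun H : Subgroup M.Pi => H.map iso.toMulEquiv.toMonoidHom) '' M.theta = M'.theta

end MonoThetaEnv

/-! ## Definition 1.1 (i): the groups reconstructed from a mono-theta environment -/

/-- **IUTchII:Def1.1(i)** (kurims pp. 20–21), the OUTPUT of the functorial algorithms
`M ↦ Π_Y(M), Π_X(M), G(M), Δ_M, Δ_Y(M), Δ_X(M), (l·Δ_Θ)(M), Π_μ(M)`: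
"a quotient `Π_M ↠ Π_Y(M)` [cf. [EtTh], Corollary 2.18, (iii)]; a topological group `Π_X(M)` which is
isomorphic to `Π^tp_{X̲̲_k}` and contains `Π_Y(M)` as a normal open subgroup [cf. [EtTh], Corollary 2.18,
(iii)]; a quotient `Π_X(M) ↠ G(M)` corresponding to `G_k` [cf. [EtTh], Corollary 2.18, (i)], which may
also be thought of as a quotient `Π_M ↠ Π_Y(M) ↠ G(M)`; … a subquotient `(l·Δ_Θ)(M)` of `Π_Y(M)` which
admits a natural `Π_X(M)`-action [hence also a `Π_Y(M)`-action, as well as, by composition, a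
`Π_M`-action] relative to which it is abstractly isomorphic to `Ẑ(1)` [cf. [EtTh], Corollary 2.18, (i)];
a closed normal subgroup `Π_μ(M) := Ker(Π_M ↠ Π_Y(M)) ⊆ Π_M` [cf. [EtTh], Corollary 2.19, (i)] which
admits a natural `Π_X(M)`-action … relative to which it is abstractly isomorphic to `(ℤ/Nℤ)(1)`. Also,
we recall that the structure of `M` determines a lifting of the natural outer action of
`(l·ℤ)(M) := Π_X(M)/Π_Y(M) ≅ Δ_X(M)/Δ_Y(M)` on `Δ_Y(M)` to an outer action of `(l·ℤ)(M)` on `Δ_M`."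
The closed normal subgroups `Δ_M, Δ_Y(M), Δ_X(M)` are the kernels DEFINED below (`DeltaM`, `DeltaY`,
`DeltaX`), exactly as printed. "Corresponding to `G_k`" is typed: some isomorphism `Π_X(M) ≅ Π^tp_{X̲̲_k}`
carries `Ker(Π_X(M) ↠ G(M))` onto `Δ^tp_{X̲̲_k}`. "Abstractly isomorphic to `Ẑ(1)`", "`(ℤ/Nℤ)(1)`": an
isomorphism of the underlying abstract groups with `Ẑ`, `ℤ/Nℤ` (the Tate twist refers to the recorded
action, not to the abstract group). [claim: Mochizuki2012, status: disputed] (IUTchII §1 Def 1.1 (i), kurims pp.20-21) -/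
structure Reconstruction {S : ThetaSetting.{u}} (M : MonoThetaEnv S) : Type (u + 1) where
  /-- `Π_Y(M)`, the target of the quotient `Π_M ↠ Π_Y(M)` -/
  PiY : TopGroup.{u}
  /-- the quotient map `Π_M ↠ Π_Y(M)` -/
  projY : M.Pi →* PiY
  projY_continuous : Continuous projY
  projY_surjective : Function.Surjective projY
  projY_quotientMap : Topology.IsQuotientMap projY
  /-- "a closed normal subgroup `Π_μ(M) := Ker(Π_M ↠ Π_Y(M))`" (closedness recorded: `TopGroup` assumes no
  separation) -/
  isClosed_ker_projY : IsClosed (projY.ker : Set M.Pi)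
  /-- `Π_X(M)`, "a topological group which is isomorphic to `Π^tp_{X̲̲_k}`" (an isomorphism is supplied by
  `projG_corresponds` below) -/
  PiX : TopGroup.{u}
  /-- the inclusion `Π_Y(M) ⊆ Π_X(M)` "as a normal open subgroup" -/
  inclY : PiY →* PiX
  inclY_isOpenEmbedding : Topology.IsOpenEmbedding inclY
  inclY_normal : inclY.range.Normal
  /-- `G(M)`, the target of the quotient `Π_X(M) ↠ G(M)` -/
  G : TopGroup.{u}
  /-- the quotient map `Π_X(M) ↠ G(M)` -/
  projG : PiX →* G
  projG_continuous : Continuous projG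
  projG_surjective : Function.Surjective projG
  projG_quotientMap : Topology.IsQuotientMap projG
  /-- "a closed normal subgroup `Δ_X(M) := Ker(Π_X(M) ↠ G(M))`" (hence `Δ_Y(M)`, `Δ_M`, its continuous
  preimages, are closed) -/
  isClosed_ker_projG : IsClosed (projG.ker : Set PiX)
  /-- "corresponding to `G_k`": some isomorphism with `Π^tp_{X̲̲_k}` carries the kernel onto `Δ^tp_{X̲̲_k}` -/
  projG_corresponds : ∃ e : PiX ≃ₜ* S.PiX, projG.ker.map e.toMulEquiv.toMonoidHom = S.DeltaX
  /-- the interior cyclotome `(l·Δ_Θ)(M)`, "a subquotient of `Π_Y(M)`" -/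
  intCyc : Subquotient PiY
  /-- "which admits a natural `Π_X(M)`-action" -/
  intAct : PiX →* MulAut intCyc.carrier
  /-- "relative to which it is abstractly isomorphic to `Ẑ(1)`" (abstract group structure) -/
  int_iso_ZHat : Nonempty (intCyc.carrier ≃* Literature.IUT.HodgeTheaters.ZHat)
  /-- the natural `Π_X(M)`-action on the exterior cyclotome `Π_μ(M) = Ker(Π_M ↠ Π_Y(M))` -/
  extAct : PiX →* MulAut projY.ker
  /-- "relative to which it is abstractly isomorphic to `(ℤ/Nℤ)(1)`" (abstract group structure) -/
  ext_iso_ZMod : Nonempty (projY.ker ≃* Multiplicative (ZMod S.N))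
  /-- the printed isomorphism `(l·ℤ)(M) := Π_X(M)/Π_Y(M) ≅ Δ_X(M)/Δ_Y(M)`: `Π_Y(M)` surjects onto `G(M)` -/
  projG_inclY_surjective : Function.Surjective (projG.comp inclY)
  /-- a WEAKER pointwise consequence of "the structure of `M` determines a lifting of the natural outer
  action of `(l·ℤ)(M) := Π_X(M)/Π_Y(M)` on `Δ_Y(M)` to an outer action of `(l·ℤ)(M)` on `Δ_M`" ([EtTh] Def.
  2.13, Prop. 2.14 (i)): every `x ∈ Π_X(M)` admits an automorphism of `Δ_M = Ker(Π_M ↠ G(M))` lifting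
  conjugation by `x` on `Δ_Y(M)` (the homomorphism `(l·ℤ)(M) → Out(Δ_M)` itself is not recorded) -/
  outer_action_lifts : ∀ x : PiX, ∃ φ : MulAut (projG.comp (inclY.comp projY)).ker,
    ∀ δ : (projG.comp (inclY.comp projY)).ker,
      inclY (projY (φ δ : M.Pi)) = x * inclY (projY (δ : M.Pi)) * x⁻¹

namespace Reconstruction

variable {S : ThetaSetting.{u}} {M : MonoThetaEnv S} (R : Reconstruction M)

/-- `Δ_M := Ker(Π_M ↠ G(M)) ⊆ Π_M` (via `Π_M ↠ Π_Y(M) ↠ G(M)`), Def. 1.1 (i).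
[claim: Mochizuki2012, status: disputed] (IUTchII §1 Def 1.1 (i), kurims p.21) -/
abbrev DeltaM : Subgroup M.Pi := (R.projG.comp (R.inclY.comp R.projY)).ker

/-- `Δ_Y(M) := Ker(Π_Y(M) ↠ G(M)) ⊆ Π_Y(M)`, Def. 1.1 (i). [claim: Mochizuki2012, status: disputed] (IUTchII §1 Def 1.1 (i), kurims p.21) -/
abbrev DeltaY : Subgroup R.PiY := (R.projG.comp R.inclY).ker

/-- `Δ_X(M) := Ker(Π_X(M) ↠ G(M)) ⊆ Π_X(M)` "corresponding to `Δ^tp_{X̲̲_k}`", Def. 1.1 (i).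
[claim: Mochizuki2012, status: disputed] (IUTchII §1 Def 1.1 (i), kurims p.21) -/
abbrev DeltaX : Subgroup R.PiX := R.projG.ker

/-- `Π_μ(M) := Ker(Π_M ↠ Π_Y(M)) ⊆ Π_M`, the **exterior cyclotome** (Def. 1.1 (i), (ii)).
[claim: Mochizuki2012, status: disputed] (IUTchII §1 Def 1.1 (ii), kurims p.21) -/
abbrev extCyc : Subgroup M.Pi := R.projY.ker

/-- `(l·ℤ)(M) := Π_X(M)/Π_Y(M)` (Def. 1.1 (i)), as the quotient by the (normal) image of `Π_Y(M)`.
[claim: Mochizuki2012, status: disputed] (IUTchII §1 Def 1.1 (i), kurims p.21) -/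
def lZ : Type u :=
  haveI := R.inclY_normal
  R.PiX ⧸ R.inclY.range

end Reconstruction

/-! **Existence clauses.** "There exist functorial algorithms `M ↦ Π_Y(M); …`" (Def. 1.1 (i), citing [EtTh]
Cor. 2.18 (i), (iii), 2.19 (i)) and "there is a functorial algorithm for constructing … a cyclotomic rigidity
isomorphism" (Def. 1.1 (ii)) are NOT typed as named facts here (review of p404540: over this interface the
only honest forms are either trivially provable by transport along `MonoThetaEnv.isModel` or false for junk
settings). The existence content is the CONSTRUCTION of `Def11Output (model)` for the genuine mono-theta
environment of [EtTh] (owner abc-iut-L2-t2); functoriality = transport of `Def11Output` along `MonoThetaEnv.Iso`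
(routine; to be added as a proved definition at merge). -/

/-! ## Definition 1.1 (ii): the cyclotomic rigidity isomorphism -/

/-- **IUTchII:Def1.1(ii)** (kurims p. 21): "`(l·Δ_Θ)(M)` (resp. `Π_μ(M)`) is the *interior* (resp.
*exterior*) *cyclotome* associated to `M`. By [EtTh], Corollary 2.19, (i), there is a functorial
algorithm for constructing from `M` a *cyclotomic rigidity isomorphism*
`(l·Δ_Θ)(M) ⊗ (ℤ/Nℤ) ≅ Π_μ(M)` between the reductions modulo `N` of the interior and exterior
cyclotomes." OUTPUT data over a `Reconstruction`: an isomorphism of abstract groups from the mod-`N`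
reduction `(l·Δ_Θ)(M)/N` (quotient by `N`-th powers, written multiplicatively) onto `Π_μ(M)`,
equivariant for the natural `Π_X(M)`-actions. [claim: Mochizuki2012, status: disputed] (IUTchII §1 Def 1.1 (ii), kurims p.21) -/
structure CyclotomicRigidity {S : ThetaSetting.{u}} {M : MonoThetaEnv S} (R : Reconstruction M) :
    Type u where
  /-- the isomorphism `(l·Δ_Θ)(M) ⊗ ℤ/Nℤ ≅ Π_μ(M)` on the mod-`N` reduction -/
  iso : ModPow R.intCyc.carrier (S.N : ℕ) ≃* R.extCyc
  /-- `Π_X(M)`-equivariance ("isomorphism of cyclotomes") -/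
  equivariant : ∀ (x : R.PiX) (c : R.intCyc.carrier),
    iso (QuotientGroup.mk (R.intAct x c)) = R.extAct x (iso (QuotientGroup.mk c))

/-- **IUTchII:Def1.1(i)** + **IUTchII:Def1.1(ii)**, the bundled OUTPUT of the Definition 1.1 algorithms on
`M`: the reconstructed groups/cyclotomes WITH their natural actions AND the cyclotomic rigidity
isomorphism between those very cyclotomes (so that the equivariance of (ii) refers to the actions produced
by the same algorithm, not to arbitrary ones). [claim: Mochizuki2012, status: disputed] (IUTchII §1 Def 1.1, kurims pp.20-21) -/
structure Def11Output {S : ThetaSetting.{u}} (M : MonoThetaEnv S) : Type (u + 1) where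
  /-- the Def. 1.1 (i) output -/
  recon : Reconstruction M
  /-- the Def. 1.1 (ii) cyclotomic rigidity isomorphism for `recon` -/
  rigidity : CyclotomicRigidity recon

end Literature.IUT.HodgeArakelov
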